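import Literature.AlgebraicGeometry.ShimuraVarieties.UnitaryBallQuotientKaehlerClass
import Literature.AlgebraicGeometry.ShimuraVarieties.UnitaryBallRealPoints
import Literature.AlgebraicGeometry.HodgeTheory.BettiUniverseNormalisedTrace
import HarnessLib

/-!
# The Kähler class system of compact unitary ball quotients: `Exists.choose` API of the named fact
# `BallQuotientKaehlerClassSystem` (row B3-25 (b2) of the `hodgecm-mathlib` cell) — theorems only, debt 0

Topic `AlgebraicGeometry/ShimuraVarieties`; namespace `Literature.AlgebraicGeometry.ShimuraVarieties`.  The fact
(`UnitaryBallQuotientKaehlerClass`: ∃ `ω : X ↦ ω_X ∈ H²(X(ℂ); ℚ)`, Kähler on every `X` carrying a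
`UnitaryBallUniformisationDatum p X`, and `f^* ω_X = ω_{X'}` for morphisms `f : X' ⟶ X` lying over an isometry `g` of the
hermitian spaces, `f(ℂ) (unif' v) = unif (g v)` on the cone; print `ω_X = c₁(K_X)`, Kollár 1995 Thm. 5.22, Voisin I
Thm. 7.10, Hartshorne II Prop. 8.11 / III Ex. 10.3) and the choice `BallQuotientKaehlerClassSystem.omega h X := h.choose X`
live in the imported file; here, for a hypothesis `h : BallQuotientKaehlerClassSystem`:

* `isKaehlerClass_omega` — clause (i) for `h.omega`;
* `pull_omega` — clause (ii) for `h.omega`, verbatim;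
* `pull_omega_of_mem_realPoints` — (ii) in the currency of the tree's Hecke translates
  (`HodgeCM.Model.LevelTranslate.map_transMor_unif`, `LevelCoveringTwist.exists_hom_map_unif_eq_mulVec`): equal complex Gram
  matrices `𝒟'.Hℂ = 𝒟.Hℂ` and `g ∈ 𝒟.realPoints = U(H^{τ₁})` (`ConeChart.mem_unitaryGroup_conj_iff`: `gᴴ H g = H`);
* `pull_omega_of_Hℂ_eq` — (ii) in the currency of the tree's level coverings
  (`HodgeCM.Model.CoverInstance.map_levelCover_unif`): equal Gram matrices and `f(ℂ) ∘ unif' = unif` (`g = 1`);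
* `trC_cup_omega_omega_ne_zero` — on a surface, `trC 4 ((1 ⊗ ω_X) ∪ (1 ⊗ ω_X)) ≠ 0`
  (`BettiUniverse.trC_cup_self_ne_zero_of_isKaehlerClass`, row B3-26 (b3); Voisin I Cor. 3.9), the denominator of the
  `ω`-normalised Hodge–Riemann forms of the consumer (III-4′(b), «Matsushima at the pin»).
So on the Picard modular tower of `HodgeCM.Model` both `levelCover` and `transMor` pull `h.omega` back to `h.omega`
by ONE application each (inputs `ballDatum_Hℂ_eq`, `map_ι₁_mem_realPoints` and the two junction lemmas).

## References
* [Kollar1995ShafarevichMaps] J. Kollár, *Shafarevich Maps and Automorphic Forms*, Princeton UP 1995, Ch. 5 Thm. 5.22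
  (pp. 69–70); Ch. 8 §§8.1–8.3 (pp. 92–93).
* [VoisinHodgeI2002] C. Voisin, *Hodge Theory and Complex Algebraic Geometry I*, CUP 2002, §3.1.3 Cor. 3.9, §3.3.2,
  Thm. 7.10.
* [Hartshorne1977] R. Hartshorne, *Algebraic Geometry*, GTM 52, II Prop. 8.11 (p. 176), III Ex. 10.3 (p. 275).
* [BergeronMillsonMoeglin2016Balls] N. Bergeron, J. Millson, C. Moeglin, Acta Math. 216 (2016), Part 2 §§1.1–1.4, §1.8.
-/

noncomputable section

open scoped Matrix TensorProduct
open CategoryTheory Matrix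
open Literature.AlgebraicGeometry.Motives (SchemeOver ComplexPoints AlgPoints bettiCohomology)
open Literature.AlgebraicGeometry.HodgeTheory (IsKaehlerClass ofRatClass)
open Literature.AlgebraicGeometry.HodgeTheory.BettiUniverse (pull trC cup)

namespace Literature.AlgebraicGeometry.ShimuraVarieties

namespace BallQuotientKaehlerClassSystem

/-- (i) `ofRatClass ω_X` is a Kähler class of the compact ball quotient `X` (dimension `p` read off the datum).
[cite: Kollar1995ShafarevichMaps, Ch. 5 Thm. 5.22 pp. 69–70] [cite: VoisinHodgeI2002, §3.3.2 and Thm. 7.10] -/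
theorem isKaehlerClass_omega (h : BallQuotientKaehlerClassSystem) {p : ℕ} {X : SchemeOver ℂ}
    (𝒟 : UnitaryBallUniformisationDatum p X) :
    IsKaehlerClass p X (ofRatClass (ComplexPoints X) 2 (h.omega X)) :=
  h.choose_spec.1 ⟨𝒟⟩

/-- (ii) `f^* ω_X = ω_{X'}` for a morphism `f : X' ⟶ X` lying over an isometry `g` of the hermitian spaces,
`f(ℂ) (unif' v) = unif (g v)` on the cone. [cite: Hartshorne1977, II Prop. 8.11 p. 176; III Ex. 10.3 p. 275]
[cite: BergeronMillsonMoeglin2016Balls, Part 2 §§1.1–1.4] -/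
theorem pull_omega (h : BallQuotientKaehlerClassSystem) {p : ℕ} {X X' : SchemeOver ℂ}
    (𝒟 : UnitaryBallUniformisationDatum p X)
    (𝒟' : UnitaryBallUniformisationDatum p X') (g : Matrix (Fin (p + 1)) (Fin (p + 1)) ℂ) (f : X' ⟶ X)
    (hg : gᴴ * 𝒟.Hℂ * g = 𝒟'.Hℂ)
    (hf : ∀ v ∈ 𝒟'.cone, AlgPoints.map f (𝒟'.unif v) = 𝒟.unif (g *ᵥ v)) :
    pull f 2 (h.omega X) = h.omega X' :=
  h.choose_spec.2 𝒟 𝒟' g f hg hf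

/-- (ii) in the currency of the tree's Hecke translates (`HodgeCM.Model.LevelTranslate.map_transMor_unif`,
`LevelCoveringTwist.exists_hom_map_unif_eq_mulVec`): the two data have the same complex Gram matrix and `g ∈ U(H^{τ₁})`
(`𝒟.realPoints`). [cite: BergeronMillsonMoeglin2016Balls, Part 2 §1.2 and §1.8] -/
theorem pull_omega_of_mem_realPoints (h : BallQuotientKaehlerClassSystem) {p : ℕ} {X X' : SchemeOver ℂ}
    (𝒟 : UnitaryBallUniformisationDatum p X)
    (𝒟' : UnitaryBallUniformisationDatum p X') (hH : 𝒟'.Hℂ = 𝒟.Hℂ) {g : GL (Fin (p + 1)) ℂ}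
    (hg : g ∈ 𝒟.realPoints) (f : X' ⟶ X)
    (hf : ∀ v ∈ 𝒟'.cone,
      AlgPoints.map f (𝒟'.unif v) = 𝒟.unif ((g : Matrix (Fin (p + 1)) (Fin (p + 1)) ℂ) *ᵥ v)) :
    pull f 2 (h.omega X) = h.omega X' :=
  h.pull_omega 𝒟 𝒟' (g : Matrix (Fin (p + 1)) (Fin (p + 1)) ℂ) f
    (by rw [ConeChart.mem_unitaryGroup_conj_iff.mp hg, hH]) hf

/-- (ii) in the currency of the tree's level coverings (`HodgeCM.Model.CoverInstance.map_levelCover_unif`,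
`LevelCovering.exists_hom_map_unif_eq`): same complex Gram matrix and `f(ℂ) ∘ unif' = unif` on the cone (`g = 1`).
[cite: BergeronMillsonMoeglin2016Balls, Part 2 §1.4] -/
theorem pull_omega_of_Hℂ_eq (h : BallQuotientKaehlerClassSystem) {p : ℕ} {X X' : SchemeOver ℂ}
    (𝒟 : UnitaryBallUniformisationDatum p X)
    (𝒟' : UnitaryBallUniformisationDatum p X') (hH : 𝒟'.Hℂ = 𝒟.Hℂ) (f : X' ⟶ X)
    (hf : ∀ v ∈ 𝒟'.cone, AlgPoints.map f (𝒟'.unif v) = 𝒟.unif v) :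
    pull f 2 (h.omega X) = h.omega X' :=
  h.pull_omega 𝒟 𝒟' 1 f (by rw [conjTranspose_one, Matrix.one_mul, Matrix.mul_one, hH])
    (fun v hv ↦ by rw [Matrix.one_mulVec]; exact hf v hv)

/-- On a surface (`p = 2`) the self-intersection of `ω_X` has non-zero light trace:
`trC 4 ((1 ⊗ ω_X) ∪ (1 ⊗ ω_X)) ≠ 0` (`BettiUniverse.trC_cup_self_ne_zero_of_isKaehlerClass`, Voisin I Cor. 3.9
`[ω]ⁿ ≠ 0`) — the denominator of the `ω`-normalised Hodge–Riemann forms. [cite: VoisinHodgeI2002, §3.1.3 Cor. 3.9] -/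
theorem trC_cup_omega_omega_ne_zero (h : BallQuotientKaehlerClassSystem) {X : SchemeOver ℂ}
    (𝒟 : UnitaryBallUniformisationDatum 2 X) :
    trC 𝒟.isSmoothProjective 4
        (LinearMap.BilinMap.baseChange ℂ (cup X 2 2) ((1 : ℂ) ⊗ₜ[ℚ] h.omega X) ((1 : ℂ) ⊗ₜ[ℚ] h.omega X)) ≠ 0 :=
  HodgeTheory.BettiUniverse.trC_cup_self_ne_zero_of_isKaehlerClass 𝒟.isSmoothProjective (h.omega X)
    (h.isKaehlerClass_omega 𝒟)

end BallQuotientKaehlerClassSystem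

end Literature.AlgebraicGeometry.ShimuraVarieties

end
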